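import Summits.HodgeConjecture.HodgeConjecture.Theorems.F0P3XiPacketFamilyOfRecord
import Summits.HodgeConjecture.HodgeConjecture.Theorems.F0P3XiLocalFamilyOfRecordUnram
import HarnessLib

/-!
# THE ξ-LOCAL FAMILY OF RECORD, EDITION 2 (II): law `XiUnram` — the Keys-labelled member `πⁿ(ξ_v)` of `packFin₀ ξ` is admissible and `K_v`-spherical
# with its eigencharacter off a FINITE set `ramOfRecord₂ ξ` (Rogawski §12.2 (2), §13.1; RULINGS (V27) (B), (V28))

Cell `hodgecm-mathlib`, F0∕P3 «U3-mult», crux H413 (`stmt-HodgeConjecture-24833`), rung 4 (F0P3-p01 (g7)).  DEF LANE: ONE definition (`ramOfRecord₂`) + theorems.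
Part (I) ED. 2 = ★ `Theorems/F0P3XiPacketFamilyOfRecord.lean` (`xiPacketFamilyOfRecord`, law `xiFamilyFin`).  Under RULING (V28) the πⁿ-of-record at a non-split
`v` is THE Keys label (non-square-integrable constituent); its sphericity at almost every `v` is a PROPERTY — the cofinite letter (L-i′)
`xiPinSphericalCofinite` [Rogawski1990 Thm. 13.3.6 (b) (p. 202) + Flath Thm. 3; B-p08 (g19)] — entering here as the hypothesis
`hexc : ∀ᶠ v in cofinite, ∀ hns, ((keys ξ v hns).πn).IsSpherical K_v`; everything else is in-house: admissibility of the Keys constituent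
(★ `isAdmissible_of_keysLabels`: constituents of the admissible `i_G(χ_ξ,v)`), transport along the level-matching congruence of record (★ p817760
`comap_isAdmissible_isSpherical`, ★ p818229), the split side (★ p817781), the eigencharacter currency (★ `IsSpherical.isSphericalWith_smoothTrace`).

CONTENTS.  §1 `isAdmissible_isSpherical_πn_of_nonsplit ∕ _of_split ∕ _of_good`, `xiUnram_xiPacketFamilyOfRecord_of_good` (any Haar `μ` on `G′_v`);
§2 `finite_setOf_not_good₂ (hexc)`, the definition **`ramOfRecord₂ ξ hexc : Finset`**, `good_of_not_mem_ramOfRecord₂`, **`xiUnram_xiPacketFamilyOfRecord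
(hv : v ∉ ramOfRecord₂ … ξ hexc)`** and `eventually_xiUnram_xiPacketFamilyOfRecord` — at ED. 4: `ram₀ ξ := ramOfRecord₂ … ξ hexc`, law `xiUnram` := `exact`.

References: [Rogawski1990] §4.5 p. 45, §12.2 (2) pp. 173–174, §13.1 p. 199, §13.3 Thm. 13.3.6 (b) (p. 202), §13.7 (p. 208), §14.2 pp. 232–233;
[CartierCorvallis1979] §IV.1 Thm. 4.1 ∕ Cor. 4.1; [TateThesis1967] Lemma 3.2.1; [FlathCorvallis1979] Thm. 3; [BushnellHenniart2006] §2.1.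
HC_CM is proved only modulo the printed citations until rung 0 closes.
-/

set_option autoImplicit false
set_option linter.dupNamespace false

noncomputable section

open NumberField IsDedekindDomain MeasureTheory Filter Topology
open scoped Matrix MatrixGroups

namespace Summit.HodgeConjecture.HodgeConjecture.Cruxes.H413.F0P3XiPacketFamilyOfRecord

open Literature.NumberTheory Literature.NumberTheory.Automorphic Literature.NumberTheory.Automorphic.UnitaryGroup
open Literature.NumberTheory.Rogawski1990 Literature.NumberTheory.GaloisRepresentations
open F0P3XiLocalFamilyOfRecord

section RamSet

variable (L : Type) [Field L] [NumberField L] [IsCMField L] (H : Matrix (Fin 3) (Fin 3) L)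
  (hH : (H.map (cmConjRingHom L))ᵀ = H) (hHd : IsUnit H.det) (μω : HeckeCharacter L)
  [∀ v : HeightOneSpectrum (𝓞 ↥(maximalRealSubfield L)), MeasurableSpace (Gqs L v ⧸ Subgroup.center (Gqs L v))]
  (μZ : ∀ v : HeightOneSpectrum (𝓞 ↥(maximalRealSubfield L)), Measure (Gqs L v ⧸ Subgroup.center (Gqs L v)))
  (keys : ∀ (ξ : OneDimAutRepH L) (v : HeightOneSpectrum (𝓞 ↥(maximalRealSubfield L))),
    (∀ w : PlacesOver L v, IsCMField.complexConj L • w.1 = w.1) →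
      {p : IrrClass (Gqs L v) × IrrClass (Gqs L v) //
        KeysCaseTwoLabels L v (μω.semilocalComponent L v) (torusLocalComponent L (IsCMField.complexConj L) v ξ.η)
          (torusLocalComponent L (IsCMField.complexConj L) v ξ.ψ) p.1 p.2 ∧
        p.1.IsSquareIntegrable (μZ v) ∧ ¬ p.2.IsSquareIntegrable (μZ v)})

/-! ## §1 The finite exceptional set `ramOfRecord₂ ξ` -/

include hH in
/-- **The good places are all but finitely many**, GIVEN the cofinite sphericity of the Keys member (hypothesis `hexc` = letter (L-i′)
`xiPinSphericalCofinite` [Thm. 13.3.6 (b) (p. 202) + Flath Thm. 3]): `η̃, ψ̃, μ` unramified above `v` and `H_w ∈ GL₃(𝒪_w)` a.e. (★ p817781 §4), a level-matching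
congruence at a.e. non-split `v` (★ p818229). [cite: Rogawski1990, §13.3 Thm. 13.3.6 (b) p. 202; §14.2 p. 233] [cite: TateThesis1967, Lemma 3.2.1] -/
theorem finite_setOf_not_good₂ (ξ : OneDimAutRepH L)
    (hexc : ∀ᶠ v : HeightOneSpectrum (𝓞 ↥(maximalRealSubfield L)) in cofinite,
      ∀ hns : ∀ w : PlacesOver L v, IsCMField.complexConj L • w.1 = w.1,
        ((keys ξ v hns).1.2).IsSpherical (cmLocalIntegralLevel L 3 (qsForm L) v)) :
    {v : HeightOneSpectrum (𝓞 ↥(maximalRealSubfield L)) | ¬ ((∀ w : PlacesOver L v, ξ.bcη.IsUnramifiedAt w.1 ∧ ξ.bcψ.IsUnramifiedAt w.1 ∧ μω.IsUnramifiedAt w.1 ∧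
          (isUnit_placeForm_of_isUnit_det hHd w.1).unit ∈ glInt 3 (w.1.adicCompletion L)) ∧
        (∀ hns : ∀ w : PlacesOver L v, IsCMField.complexConj L • w.1 = w.1,
          (∃ (T' : GL (Fin 3) (LocalRing L v)) (a' : LocalRing L v) (ha' : IsUnit a')
          (h' : formCongr (conjLocal L (IsCMField.complexConj L) v) T' (H.map (algebraMap L (LocalRing L v))) =
            a' • (Matrix.of fun i j : Fin 3 => if i.val + j.val + 1 = 3 then (1 : L) else 0).map (algebraMap L (LocalRing L v))),
          ∀ g : (cmDatum L 3 H).Local v, (cmDatumLocalCongr L v T' ha' h').symm g ∈ cmLocalIntegralLevel L 3 (qsForm L) v ↔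
            g ∈ cmLocalIntegralLevel L 3 H v) ∧
          ((keys ξ v hns).1.2).IsSpherical (cmLocalIntegralLevel L 3 (qsForm L) v)))}.Finite := by
  rw [← Filter.eventually_cofinite]
  filter_upwards [F0P3XiUnramSplitInstance.eventually_forall_placesOver_splitUnram (H := H) ξ μω hHd,
    eventually_exists_cmDatumLocalCongr_levelMatching_three L H hH hHd, hexc] with v h₁ h₂ h₃
  exact ⟨h₁, fun hns => ⟨h₂ hns, h₃ hns⟩⟩

/-- **`ramOfRecord₂ ξ` — THE FINITE EXCEPTIONAL SET of the ED. 2 record** (the 𝔠₀ reading of `ram ξ`): the places where «`η̃, ψ̃, μ` unramified above `v`»,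
«`H_w ∈ GL₃(𝒪_w)`», or (non-split) «a level-matching congruence exists» ∕ «the Keys `πⁿ` is `K_v`-spherical» FAILS; finite by `finite_setOf_not_good₂`.
[cite: Rogawski1990, §12.2 pp. 173–174; §13.1 p. 199; §13.3 Thm. 13.3.6 (b) p. 202] -/
def ramOfRecord₂ (ξ : OneDimAutRepH L)
    (hexc : ∀ᶠ v : HeightOneSpectrum (𝓞 ↥(maximalRealSubfield L)) in cofinite,
      ∀ hns : ∀ w : PlacesOver L v, IsCMField.complexConj L • w.1 = w.1,
        ((keys ξ v hns).1.2).IsSpherical (cmLocalIntegralLevel L 3 (qsForm L) v)) :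
    Finset (HeightOneSpectrum (𝓞 ↥(maximalRealSubfield L))) :=
  (finite_setOf_not_good₂ L H hH hHd μω μZ keys ξ hexc).toFinset

/-- Off `ramOfRecord₂ ξ` the place is good. [cite: Rogawski1990, §12.2 pp. 173–174] -/
theorem good_of_not_mem_ramOfRecord₂ (ξ : OneDimAutRepH L)
    {hexc : ∀ᶠ v : HeightOneSpectrum (𝓞 ↥(maximalRealSubfield L)) in cofinite,
      ∀ hns : ∀ w : PlacesOver L v, IsCMField.complexConj L • w.1 = w.1,
        ((keys ξ v hns).1.2).IsSpherical (cmLocalIntegralLevel L 3 (qsForm L) v)}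
    {v : HeightOneSpectrum (𝓞 ↥(maximalRealSubfield L))} (hv : v ∉ ramOfRecord₂ L H hH hHd μω μZ keys ξ hexc) :
    (∀ w : PlacesOver L v, ξ.bcη.IsUnramifiedAt w.1 ∧ ξ.bcψ.IsUnramifiedAt w.1 ∧ μω.IsUnramifiedAt w.1 ∧
          (isUnit_placeForm_of_isUnit_det hHd w.1).unit ∈ glInt 3 (w.1.adicCompletion L)) ∧
        (∀ hns : ∀ w : PlacesOver L v, IsCMField.complexConj L • w.1 = w.1,
          (∃ (T' : GL (Fin 3) (LocalRing L v)) (a' : LocalRing L v) (ha' : IsUnit a')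
          (h' : formCongr (conjLocal L (IsCMField.complexConj L) v) T' (H.map (algebraMap L (LocalRing L v))) =
            a' • (Matrix.of fun i j : Fin 3 => if i.val + j.val + 1 = 3 then (1 : L) else 0).map (algebraMap L (LocalRing L v))),
          ∀ g : (cmDatum L 3 H).Local v, (cmDatumLocalCongr L v T' ha' h').symm g ∈ cmLocalIntegralLevel L 3 (qsForm L) v ↔
            g ∈ cmLocalIntegralLevel L 3 H v) ∧
          ((keys ξ v hns).1.2).IsSpherical (cmLocalIntegralLevel L 3 (qsForm L) v)) := by
  rw [ramOfRecord₂, Set.Finite.mem_toFinset, Set.mem_setOf_eq, not_not] at hv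
  exact hv


end RamSet

section Unram

variable (L : Type) [Field L] [NumberField L] [IsCMField L] (H : Matrix (Fin 3) (Fin 3) L)
  (hH : (H.map (cmConjRingHom L))ᵀ = H) (hHd : IsUnit H.det) (μω : HeckeCharacter L) (hμu : μω.IsUnitary)
  -- the local data SHARED with T1's `ComparisonKit` ∕ F0P3b's `CMCharIdentityClauses` ((χ1), RULING (V28)); instance families as there (`borel` at 𝔠₀)
  [∀ v : HeightOneSpectrum (𝓞 ↥(maximalRealSubfield L)), MeasurableSpace ((cmDatum L 3 H).Local v)]
  [∀ v : HeightOneSpectrum (𝓞 ↥(maximalRealSubfield L)),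
    MeasurableSpace ((cmDatum L 2 (Matrix.of fun i j : Fin 2 => if i.val + j.val + 1 = 2 then (1 : L) else 0)).Local v ×
      (cmDatum L 1 (Matrix.of fun i j : Fin 1 => if i.val + j.val + 1 = 1 then (1 : L) else 0)).Local v)]
  [∀ (v : HeightOneSpectrum (𝓞 ↥(maximalRealSubfield L)))
      (a : ((cmDatum L 2 (Matrix.of fun i j : Fin 2 => if i.val + j.val + 1 = 2 then (1 : L) else 0)).Local v ×
        (cmDatum L 1 (Matrix.of fun i j : Fin 1 => if i.val + j.val + 1 = 1 then (1 : L) else 0)).Local v)),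
    MeasurableSpace (((cmDatum L 2 (Matrix.of fun i j : Fin 2 => if i.val + j.val + 1 = 2 then (1 : L) else 0)).Local v ×
        (cmDatum L 1 (Matrix.of fun i j : Fin 1 => if i.val + j.val + 1 = 1 then (1 : L) else 0)).Local v) ⧸
      Subgroup.centralizer ({a} : Set ((cmDatum L 2 (Matrix.of fun i j : Fin 2 => if i.val + j.val + 1 = 2 then (1 : L) else 0)).Local v ×
        (cmDatum L 1 (Matrix.of fun i j : Fin 1 => if i.val + j.val + 1 = 1 then (1 : L) else 0)).Local v)))]
  [∀ (v : HeightOneSpectrum (𝓞 ↥(maximalRealSubfield L))) (γ : (cmDatum L 3 H).Local v),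
    MeasurableSpace ((cmDatum L 3 H).Local v ⧸ Subgroup.centralizer ({γ} : Set ((cmDatum L 3 H).Local v)))]
  [∀ v : HeightOneSpectrum (𝓞 ↥(maximalRealSubfield L)), MeasurableSpace (Gqs L v ⧸ Subgroup.center (Gqs L v))]
  (Δ : ∀ v : HeightOneSpectrum (𝓞 ↥(maximalRealSubfield L)), LocalTransferFactor L H v)
  (mH : ∀ v : HeightOneSpectrum (𝓞 ↥(maximalRealSubfield L)),
    OrbitalMeasureFamily ((cmDatum L 2 (Matrix.of fun i j : Fin 2 => if i.val + j.val + 1 = 2 then (1 : L) else 0)).Local v ×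
      (cmDatum L 1 (Matrix.of fun i j : Fin 1 => if i.val + j.val + 1 = 1 then (1 : L) else 0)).Local v))
  (mG : ∀ v : HeightOneSpectrum (𝓞 ↥(maximalRealSubfield L)), OrbitalMeasureFamily ((cmDatum L 3 H).Local v))
  (νG : ∀ v : HeightOneSpectrum (𝓞 ↥(maximalRealSubfield L)), Measure ((cmDatum L 3 H).Local v))
  (νH : ∀ v : HeightOneSpectrum (𝓞 ↥(maximalRealSubfield L)),
    Measure ((cmDatum L 2 (Matrix.of fun i j : Fin 2 => if i.val + j.val + 1 = 2 then (1 : L) else 0)).Local v ×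
      (cmDatum L 1 (Matrix.of fun i j : Fin 1 => if i.val + j.val + 1 = 1 then (1 : L) else 0)).Local v))
  (ξloc : OneDimAutRepH L → ∀ v : HeightOneSpectrum (𝓞 ↥(maximalRealSubfield L)),
    (cmDatum L 2 (Matrix.of fun i j : Fin 2 => if i.val + j.val + 1 = 2 then (1 : L) else 0)).Local v ×
      (cmDatum L 1 (Matrix.of fun i j : Fin 1 => if i.val + j.val + 1 = 1 then (1 : L) else 0)).Local v →* ℂˣ)
  (μZ : ∀ v : HeightOneSpectrum (𝓞 ↥(maximalRealSubfield L)), Measure (Gqs L v ⧸ Subgroup.center (Gqs L v)))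
  (keys : ∀ (ξ : OneDimAutRepH L) (v : HeightOneSpectrum (𝓞 ↥(maximalRealSubfield L))),
    (∀ w : PlacesOver L v, IsCMField.complexConj L • w.1 = w.1) →
      {p : IrrClass (Gqs L v) × IrrClass (Gqs L v) //
        KeysCaseTwoLabels L v (μω.semilocalComponent L v) (torusLocalComponent L (IsCMField.complexConj L) v ξ.η)
          (torusLocalComponent L (IsCMField.complexConj L) v ξ.ψ) p.1 p.2 ∧
        p.1.IsSquareIntegrable (μZ v) ∧ ¬ p.2.IsSquareIntegrable (μZ v)})
  (hCM : ∀ (ξ : OneDimAutRepH L) (v : HeightOneSpectrum (𝓞 ↥(maximalRealSubfield L)))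
    (hns : ∀ w : PlacesOver L v, IsCMField.complexConj L • w.1 = w.1)
    (T : GL (Fin 3) (LocalRing L v)) (a : LocalRing L v) (ha : IsUnit a)
    (h : formCongr (conjLocal L (IsCMField.complexConj L) v) T (H.map (algebraMap L (LocalRing L v))) =
      a • (Matrix.of fun i j : Fin 3 => if i.val + j.val + 1 = 3 then (1 : L) else 0).map (algebraMap L (LocalRing L v)))
    (π2 πn : IrrClass (Gqs L v)),
    KeysCaseTwoLabels L v (μω.semilocalComponent L v) (torusLocalComponent L (IsCMField.complexConj L) v ξ.η)
      (torusLocalComponent L (IsCMField.complexConj L) v ξ.ψ) π2 πn → ¬ πn.IsSquareIntegrable (μZ v) →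
    CMNonsplitCharIdentityAt L v H (Δ v) (mH v) (mG v) (νG v) (νH v) (ξloc ξ v) (IrrClass.comap (cmDatumLocalCongr L v T ha h).symm πn))

/-! ## §2 The record's Keys member is admissible and `K_v`-spherical at the good places -/

/-- **NON-SPLIT good place**: if a level-matching form congruence exists at `v` and the Keys label `πⁿ = (keys ξ v hns).πn` is `K_v`-spherical on
`U(Φ₃)(L⁺_v)` (the (L-i′) property), then the record's member `πⁿ ∘ e` is ADMISSIBLE (`πⁿ` is a constituent of the admissible `i_G(χ_ξ,v)`) and
`K_v`-SPHERICAL on `U(H)(L⁺_v)` (transport along the level-matching congruence of record, ★ `comap_isAdmissible_isSpherical`).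
[cite: Rogawski1990, §12.2 (2) pp. 173–174; §13.1 p. 199; §14.2 p. 233] [cite: CartierCorvallis1979, §IV.1] -/
theorem isAdmissible_isSpherical_πn_of_nonsplit (ξ : OneDimAutRepH L) (v : HeightOneSpectrum (𝓞 ↥(maximalRealSubfield L)))
    (hns : ∀ w : PlacesOver L v, IsCMField.complexConj L • w.1 = w.1)
    (hLM : (∃ (T' : GL (Fin 3) (LocalRing L v)) (a' : LocalRing L v) (ha' : IsUnit a')
          (h' : formCongr (conjLocal L (IsCMField.complexConj L) v) T' (H.map (algebraMap L (LocalRing L v))) =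
            a' • (Matrix.of fun i j : Fin 3 => if i.val + j.val + 1 = 3 then (1 : L) else 0).map (algebraMap L (LocalRing L v))),
          ∀ g : (cmDatum L 3 H).Local v, (cmDatumLocalCongr L v T' ha' h').symm g ∈ cmLocalIntegralLevel L 3 (qsForm L) v ↔
            g ∈ cmLocalIntegralLevel L 3 H v))
    (hsph : ((keys ξ v hns).1.2).IsSpherical (cmLocalIntegralLevel L 3 (qsForm L) v)) :
    (xiPacketFamilyOfRecord L H hH hHd μω hμu Δ mH mG νG νH ξloc μZ keys hCM ξ v).πn.IsAdmissible ∧ (xiPacketFamilyOfRecord L H hH hHd μω hμu Δ mH mG νG νH ξloc μZ keys hCM ξ v).πn.IsSpherical (cmLocalIntegralLevel L 3 H v) := by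
  obtain ⟨T, a, ha, h, hP, hT⟩ := xiPacketFamilyOfRecord_of_nonsplit L H hH hHd μω hμu Δ mH mG νG νH ξloc μZ keys hCM ξ v hns
  rw [hP]
  exact F0P3XiUnramNonsplitInstance.comap_isAdmissible_isSpherical L v H (cmDatumLocalCongr L v T ha h).symm (hT hLM)
    (isAdmissible_of_keysLabels L μω ξ v (keys ξ v hns).2.1) hsph

/-- **SPLIT good place**: `η̃, ψ̃, μ` unramified at the fixed witness and `H_w ∈ GL₃(𝒪_w)` ⇒ the record's member `i_G(ξ_w)` is admissible and `K_v`-spherical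
(★ p817781). [cite: Rogawski1990, §12.2 pp. 173–174; §13.1 p. 199] [cite: CartierCorvallis1979, §IV.1] -/
theorem isAdmissible_isSpherical_πn_of_split (ξ : OneDimAutRepH L) (v : HeightOneSpectrum (𝓞 ↥(maximalRealSubfield L)))
    (hs : ∃ w : PlacesOver L v, IsCMField.complexConj L • w.1 ≠ w.1)
    (hη : ξ.bcη.IsUnramifiedAt (splitWitness v hs).1) (hψ : ξ.bcψ.IsUnramifiedAt (splitWitness v hs).1)
    (hμ : μω.IsUnramifiedAt (splitWitness v hs).1)
    (hHw : (isUnit_placeForm_of_isUnit_det hHd (splitWitness v hs).1).unit ∈ glInt 3 ((splitWitness v hs).1.adicCompletion L)) :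
    (xiPacketFamilyOfRecord L H hH hHd μω hμu Δ mH mG νG νH ξloc μZ keys hCM ξ v).πn.IsAdmissible ∧ (xiPacketFamilyOfRecord L H hH hHd μω hμu Δ mH mG νG νH ξloc μZ keys hCM ξ v).πn.IsSpherical (cmLocalIntegralLevel L 3 H v) := by
  rw [xiPacketFamilyOfRecord_of_split L H hH hHd μω hμu Δ mH mG νG νH ξloc μZ keys hCM ξ v hs]
  exact ⟨F0P3XiUnramSplitInstance.isAdmissible_cmSplitPacket_πn L H hH hHd v _ _ _ _ _ _ _ _,
    F0P3XiUnramSplitInstance.isSpherical_cmSplitPacket_πn L H hH hHd v _ _ _ _ _ _ _ _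
      (F0P3XiUnramSplitInstance.splitν₀_eq_one_of_isUnramifiedAt ξ μω hη hψ hμ)
      (F0P3XiUnramSplitInstance.locψ_eq_one_of_isUnramifiedAt ξ hψ) hHw⟩

/-- **AT A GOOD PLACE (split or not)** — «good» = the conjunction defining `ramOfRecord₂` (§1) — the record's member is admissible and `K_v`-spherical.
[cite: Rogawski1990, §12.2 pp. 173–174; §13.1 p. 199] [cite: CartierCorvallis1979, §IV.1] -/
theorem isAdmissible_isSpherical_πn_of_good (ξ : OneDimAutRepH L) (v : HeightOneSpectrum (𝓞 ↥(maximalRealSubfield L)))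
    (hgood : (∀ w : PlacesOver L v, ξ.bcη.IsUnramifiedAt w.1 ∧ ξ.bcψ.IsUnramifiedAt w.1 ∧ μω.IsUnramifiedAt w.1 ∧
          (isUnit_placeForm_of_isUnit_det hHd w.1).unit ∈ glInt 3 (w.1.adicCompletion L)) ∧
        (∀ hns : ∀ w : PlacesOver L v, IsCMField.complexConj L • w.1 = w.1,
          (∃ (T' : GL (Fin 3) (LocalRing L v)) (a' : LocalRing L v) (ha' : IsUnit a')
          (h' : formCongr (conjLocal L (IsCMField.complexConj L) v) T' (H.map (algebraMap L (LocalRing L v))) =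
            a' • (Matrix.of fun i j : Fin 3 => if i.val + j.val + 1 = 3 then (1 : L) else 0).map (algebraMap L (LocalRing L v))),
          ∀ g : (cmDatum L 3 H).Local v, (cmDatumLocalCongr L v T' ha' h').symm g ∈ cmLocalIntegralLevel L 3 (qsForm L) v ↔
            g ∈ cmLocalIntegralLevel L 3 H v) ∧
          ((keys ξ v hns).1.2).IsSpherical (cmLocalIntegralLevel L 3 (qsForm L) v))) :
    (xiPacketFamilyOfRecord L H hH hHd μω hμu Δ mH mG νG νH ξloc μZ keys hCM ξ v).πn.IsAdmissible ∧ (xiPacketFamilyOfRecord L H hH hHd μω hμu Δ mH mG νG νH ξloc μZ keys hCM ξ v).πn.IsSpherical (cmLocalIntegralLevel L 3 H v) := by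
  rcases Classical.em (∃ w : PlacesOver L v, IsCMField.complexConj L • w.1 ≠ w.1) with hs | hs
  · obtain ⟨hη, hψ, hμ, hHw⟩ := hgood.1 (splitWitness v hs)
    exact isAdmissible_isSpherical_πn_of_split L H hH hHd μω hμu Δ mH mG νG νH ξloc μZ keys hCM ξ v hs hη hψ hμ hHw
  · have hns : ∀ w : PlacesOver L v, IsCMField.complexConj L • w.1 = w.1 := fun w => not_not.1 fun hw => hs ⟨w, hw⟩
    obtain ⟨hLM, hsph⟩ := hgood.2 hns
    exact isAdmissible_isSpherical_πn_of_nonsplit L H hH hHd μω hμu Δ mH mG νG νH ξloc μZ keys hCM ξ v hns hLM hsph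

/-- **The pin-(ii) currency** at a good place: for any Haar measure `μ` on `G′_v`, the record's member is `K_v`-spherical WITH the eigencharacter
`μ(K_v)⁻¹ tr πⁿ(·)` and admissible (law `XiUnram`, RULING (V11)(ii)). [cite: Rogawski1990, §13.7 p. 208; §12.2 pp. 173–174] [cite: CartierCorvallis1979, §IV.1 Cor. 4.1] -/
theorem xiUnram_xiPacketFamilyOfRecord_of_good (ξ : OneDimAutRepH L) (v : HeightOneSpectrum (𝓞 ↥(maximalRealSubfield L)))
    [BorelSpace ((cmDatum L 3 H).Local v)] (μ : Measure ((cmDatum L 3 H).Local v)) [μ.IsHaarMeasure]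
    (hgood : (∀ w : PlacesOver L v, ξ.bcη.IsUnramifiedAt w.1 ∧ ξ.bcψ.IsUnramifiedAt w.1 ∧ μω.IsUnramifiedAt w.1 ∧
          (isUnit_placeForm_of_isUnit_det hHd w.1).unit ∈ glInt 3 (w.1.adicCompletion L)) ∧
        (∀ hns : ∀ w : PlacesOver L v, IsCMField.complexConj L • w.1 = w.1,
          (∃ (T' : GL (Fin 3) (LocalRing L v)) (a' : LocalRing L v) (ha' : IsUnit a')
          (h' : formCongr (conjLocal L (IsCMField.complexConj L) v) T' (H.map (algebraMap L (LocalRing L v))) =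
            a' • (Matrix.of fun i j : Fin 3 => if i.val + j.val + 1 = 3 then (1 : L) else 0).map (algebraMap L (LocalRing L v))),
          ∀ g : (cmDatum L 3 H).Local v, (cmDatumLocalCongr L v T' ha' h').symm g ∈ cmLocalIntegralLevel L 3 (qsForm L) v ↔
            g ∈ cmLocalIntegralLevel L 3 H v) ∧
          ((keys ξ v hns).1.2).IsSpherical (cmLocalIntegralLevel L 3 (qsForm L) v))) :
    (xiPacketFamilyOfRecord L H hH hHd μω hμu Δ mH mG νG νH ξloc μZ keys hCM ξ v).πn.IsSphericalWith (cmLocalIntegralLevel L 3 H v) μ (fun f =>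
      (μ.real (cmLocalIntegralLevel L 3 H v : Set ((cmDatum L 3 H).Local v)) : ℂ)⁻¹ * (xiPacketFamilyOfRecord L H hH hHd μω hμu Δ mH mG νG νH ξloc μZ keys hCM ξ v).πn.smoothTrace μ f) ∧
      (xiPacketFamilyOfRecord L H hH hHd μω hμu Δ mH mG νG νH ξloc μZ keys hCM ξ v).πn.IsAdmissible := by
  obtain ⟨hadm, h1⟩ := isAdmissible_isSpherical_πn_of_good L H hH hHd μω hμu Δ mH mG νG νH ξloc μZ keys hCM ξ v hgood
  exact ⟨IrrClass.IsSpherical.isSphericalWith_smoothTrace μ hadm (isCompact_isOpen_cmLocalIntegralLevel L 3 H v).2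
    (isCompact_isOpen_cmLocalIntegralLevel L 3 H v).1 (F0P3XiUnramSplitInstance.measureReal_cmLocalIntegralLevel_ne_zero L H v μ) h1, hadm⟩

/-! ## §3 Law `XiUnram` off `ramOfRecord₂ ξ` -/

/-- **LAW `XiUnram` AT 𝔠₀ (ED. 2), OFF `ramOfRecord₂ ξ`**: for `v ∉ ramOfRecord₂ ξ` and any Haar measure on `G′_v`, the record's Keys member `πⁿ` is
`K_v`-spherical WITH its eigencharacter and admissible. [cite: Rogawski1990, §12.2 pp. 173–174; §13.1 p. 199; §13.7 p. 208] [cite: CartierCorvallis1979, §IV.1 Cor. 4.1] -/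
theorem xiUnram_xiPacketFamilyOfRecord (ξ : OneDimAutRepH L)
    {hexc : ∀ᶠ v : HeightOneSpectrum (𝓞 ↥(maximalRealSubfield L)) in cofinite,
      ∀ hns : ∀ w : PlacesOver L v, IsCMField.complexConj L • w.1 = w.1,
        ((keys ξ v hns).1.2).IsSpherical (cmLocalIntegralLevel L 3 (qsForm L) v)}
    (v : HeightOneSpectrum (𝓞 ↥(maximalRealSubfield L))) (hv : v ∉ ramOfRecord₂ L H hH hHd μω μZ keys ξ hexc)
    [BorelSpace ((cmDatum L 3 H).Local v)] (μ : Measure ((cmDatum L 3 H).Local v)) [μ.IsHaarMeasure] :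
    (xiPacketFamilyOfRecord L H hH hHd μω hμu Δ mH mG νG νH ξloc μZ keys hCM ξ v).πn.IsSphericalWith (cmLocalIntegralLevel L 3 H v) μ (fun f =>
      (μ.real (cmLocalIntegralLevel L 3 H v : Set ((cmDatum L 3 H).Local v)) : ℂ)⁻¹ * (xiPacketFamilyOfRecord L H hH hHd μω hμu Δ mH mG νG νH ξloc μZ keys hCM ξ v).πn.smoothTrace μ f) ∧
      (xiPacketFamilyOfRecord L H hH hHd μω hμu Δ mH mG νG νH ξloc μZ keys hCM ξ v).πn.IsAdmissible :=
  xiUnram_xiPacketFamilyOfRecord_of_good L H hH hHd μω hμu Δ mH mG νG νH ξloc μZ keys hCM ξ v μ (good_of_not_mem_ramOfRecord₂ L H hH hHd μω μZ keys ξ hv)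

/-- The same as an `∀ᶠ v in cofinite` statement for a family of Haar measures. [cite: Rogawski1990, §12.2 pp. 173–174; §13.7 p. 208] -/
theorem eventually_xiUnram_xiPacketFamilyOfRecord (ξ : OneDimAutRepH L)
    (hexc : ∀ᶠ v : HeightOneSpectrum (𝓞 ↥(maximalRealSubfield L)) in cofinite,
      ∀ hns : ∀ w : PlacesOver L v, IsCMField.complexConj L • w.1 = w.1,
        ((keys ξ v hns).1.2).IsSpherical (cmLocalIntegralLevel L 3 (qsForm L) v))
    [∀ v : HeightOneSpectrum (𝓞 ↥(maximalRealSubfield L)), BorelSpace ((cmDatum L 3 H).Local v)]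
    (μv : ∀ v : HeightOneSpectrum (𝓞 ↥(maximalRealSubfield L)), Measure ((cmDatum L 3 H).Local v)) [∀ v, (μv v).IsHaarMeasure] :
    ∀ᶠ v : HeightOneSpectrum (𝓞 ↥(maximalRealSubfield L)) in cofinite,
      (xiPacketFamilyOfRecord L H hH hHd μω hμu Δ mH mG νG νH ξloc μZ keys hCM ξ v).πn.IsSphericalWith (cmLocalIntegralLevel L 3 H v) (μv v) (fun f =>
        ((μv v).real (cmLocalIntegralLevel L 3 H v : Set ((cmDatum L 3 H).Local v)) : ℂ)⁻¹ *
          (xiPacketFamilyOfRecord L H hH hHd μω hμu Δ mH mG νG νH ξloc μZ keys hCM ξ v).πn.smoothTrace (μv v) f) ∧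
      (xiPacketFamilyOfRecord L H hH hHd μω hμu Δ mH mG νG νH ξloc μZ keys hCM ξ v).πn.IsAdmissible := by
  have h := finite_setOf_not_good₂ L H hH hHd μω μZ keys ξ hexc
  rw [← Filter.eventually_cofinite] at h
  filter_upwards [h] with v hv
  exact xiUnram_xiPacketFamilyOfRecord_of_good L H hH hHd μω hμu Δ mH mG νG νH ξloc μZ keys hCM ξ v (μv v) hv

end Unram

end Summit.HodgeConjecture.HodgeConjecture.Cruxes.H413.F0P3XiPacketFamilyOfRecord

end
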